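import Summits.QuantumFields.BalabanUV.T4Continuum.Support.MinimalActionRefine
import Summits.QuantumFields.BalabanUV.T4Continuum.Support.LevelZeroFluxGradient

/-!
# LevelZeroRegular (T⁴ programme, node NE3, formalisation swarm row S7 = skeleton leaf A-H0, part 2) —
# THE DATUM'S LEVEL-0 SUP-FORM REGULARITY: `V ∈ sfClass d L N ε 0`, `ε ≤ 1/4` ⇒ `RegularSup d L N ε (4ε) 0 V`

HONEST FRAMING (cell `pub-balaban`, T4-DAG PAGE 1; unit `b2b-balaban-t4-ne3-formalise-leaf-05`, row S7 of
`t4/formal/NE3/LEAVES.md`; skeleton `t4/b2b-balaban-t4-ne3-p1/SKELETON-NE3-P1.md` v1.1 §3 row A-H0).  The cell's T⁴ target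
is the finite-torus continuum limit of gauge-invariant observables — NOT infinite volume, NO mass gap, NOT the Clay problem,
NOT summit progress.  NE3 is NOT proved here or anywhere.  This file discharges the TRIVIAL hypothesis shape (H0) of the
owner's re-cut `MinimalActionRefine.sandwichData_of_smoothRefine` / `actionRate_sfClass_of_smoothRefine` for data of the
small-field class: the level-`0` «minimiser» is the datum itself (`MinimalActionRefine.eq_of_isMinimiser_zero`), and a datum
of class (7) has, besides unitarity, periodicity and small plaquettes, a covariant flux gradient `≤ 4ε` (part 1,
`LevelZeroFluxGradient.norm_covGrad_flux_le_of_smallField`) — no smoothness is claimed at level `0`.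

CONTENT ([folklore], 0 sorry): `regularSup_zero_of_sfClass`, its monotone form `regularSup_zero_of_sfClass_le` (fit the
pair `(b, c)` of the minimisers' regularity: `ε ≤ b`, `4ε ≤ c`), and `regularSup_zero_of_isMinimiser_sfClass` (any
level-`0` minimiser with datum in the class).  Imports BY NAME: `MinimalActionRate.sfClass`, `MinimalActionRefine.RegularSup`
/ `regularSup_of_isMinimiser_zero`, `MinimalActionSandwich.IsMinimiser`; nothing restated; no `def … : Prop`.
Context: T. Bałaban, Commun. Math. Phys. **102** (1985) 277–309 [Balaban1985Variational], class (7) p. 278.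
PLACEMENT: `Summits/QuantumFields/BalabanUV/` (human rule 2026-08-19).  Record: `t4/formal/NE3/LEAVES.md` row S7.
-/

set_option autoImplicit false

open scoped BigOperators Matrix Matrix.Norms.L2Operator
open NormedSpace

namespace Summit.QuantumFields.BalabanUV.T4Continuum.LevelZeroRegular

open Literature.MathematicalPhysics.QuantumFieldTheory.Balaban1983to89
open B7Prop1Explicit B7Prop2Explicit MatrixLog
open T4AveragingDeficitWall hiding Site Plane Plaq Bond
open MinimalActionSandwich (IsMinimiser)
open MinimalActionRate (sfClass)
open MinimalActionRefine (RegularSup regularSup_of_isMinimiser_zero)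
open LevelZeroFluxGradient (norm_covGrad_flux_le_of_smallField)

noncomputable section

variable {d : ℕ} {n : Type*} [Fintype n] [DecidableEq n]

/-- **(H0) FOR THE SMALL-FIELD CLASS**: a datum `V ∈ sfClass d L N ε 0` (unitary, `N`-periodic, `SmallField V ε`) with
`ε ≤ 1/4` has sup-form regularity `RegularSup d L N ε (4ε) 0 V` — the flux-gradient clause at level `0` is the trivial
bound `‖∇_V F‖ ≤ 4ε` of part 1. [folklore] -/
theorem regularSup_zero_of_sfClass {L N : ℕ} {ε : ℝ} (hε : ε ≤ 1 / 4)
    {V : B7Prop1Explicit.Site d → Fin d → (Matrix n n ℂ)ˣ} (hV : V ∈ sfClass d L N ε 0) :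
    RegularSup d L N ε (4 * ε) 0 V where
  unitary := hV.1
  periodic := hV.2.1
  small := hV.2.2
  grad := fun x κ π => by
    have hsm : SmallField V ε := by simpa using hV.2.2
    simpa using norm_covGrad_flux_le_of_smallField hV.1 hε hsm x κ π

/-- (H0) fitted to a given regularity pair `(b, c)` with `ε ≤ b`, `4ε ≤ c` (so the datum and the minimisers of
(H3ˢᵘᵖ) share ONE pair, as `sandwichData_of_smoothRefine` wants). [folklore] -/
theorem regularSup_zero_of_sfClass_le {L N : ℕ} {ε b c : ℝ} (hε : ε ≤ 1 / 4) (hεb : ε ≤ b) (hεc : 4 * ε ≤ c)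
    {V : B7Prop1Explicit.Site d → Fin d → (Matrix n n ℂ)ˣ} (hV : V ∈ sfClass d L N ε 0) :
    RegularSup d L N b c 0 V where
  unitary := hV.1
  periodic := hV.2.1
  small := by
    have hsm : SmallField V ε := by simpa using hV.2.2
    simpa using MinimalActionRate.SmallField.mono hsm hεb
  grad := fun x κ π => by
    have hsm : SmallField V ε := by simpa using hV.2.2
    simpa using (norm_covGrad_flux_le_of_smallField hV.1 hε hsm x κ π).trans hεc

/-- Hence every level-`0` minimiser over ANY class family `𝒞`, with datum `V ∈ sfClass d L N ε 0`, `ε ≤ 1/4`, has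
`RegularSup d L N ε (4ε) 0` (it IS `V`: `MinimalActionRefine.regularSup_of_isMinimiser_zero`). [folklore] -/
theorem regularSup_zero_of_isMinimiser_sfClass {𝒞 : ℕ → Set (B7Prop1Explicit.Site d → Fin d → (Matrix n n ℂ)ˣ)}
    {L N : ℕ} {ε : ℝ} (hε : ε ≤ 1 / 4) {V U : B7Prop1Explicit.Site d → Fin d → (Matrix n n ℂ)ˣ}
    (hV : V ∈ sfClass d L N ε 0) (hU : IsMinimiser d 𝒞 L N 0 V U) : RegularSup d L N ε (4 * ε) 0 U :=
  regularSup_of_isMinimiser_zero (regularSup_zero_of_sfClass hε hV) hU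

end

end Summit.QuantumFields.BalabanUV.T4Continuum.LevelZeroRegular
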